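import Summits.Schanuel.Schanuel.Theorems.ZilberEacDiagonalCriticalElimination
import Summits.Schanuel.Schanuel.Theorems.ZilberEacDiagonalCriticalExistence
import Summits.Schanuel.Schanuel.Theorems.ZilberEacDiagonalCriticalGeneric
import Summits.Schanuel.Schanuel.Theorems.ZilberEacRealHyperplaneDensity
import HarnessLib

/-!
# The critical size with an ARBITRARY hyperplane constant: Zariski density of the exponential
# points of `{x₂ = r₀x₀ + (1 - r₀)x₁ + c, yⱼ = xⱼ + y₂}`, `r₀ ∉ ℚ`, `c ∈ ℂ`

Zilber's Exponential-Algebraic Closedness, case ladder (host summit Schanuel, cell `pub-schanuel`,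
seat 2, gen 13).  THE FAMILY (`r₀ ∈ ℝ ∖ ℚ`, `c ∈ ℂ`):

  `W_{r,c} = {x₂ = r₀x₀ + (1 - r₀)x₁ + c,  y₀ = x₀ + y₂,  y₁ = x₁ + y₂} ⊆ ℂ³ × ℂ³`

— the critical size `λ(1 + deg F) = deg A` of O54 (a) with a hyperplane constant.  The
near-resonant regime of `ZilberEacNearResonantDensity` needs `c = 0` (more precisely `Re c` small);
here a SECOND critical regime covers every `c`:

**THEOREM (`unprojectedDense_polyFibredGraph_critical_const`).**  For irrational `r₀` and every
`c ∈ ℂ`, `I(W_{r,c} ∩ Γ_exp) = I(W_{r,c})`.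

Proof: along the DIAGONAL rays `x(m) = (2πim + log m)(1,1) + ρ(m)` the rescaled system has the
explicitly solvable nonlinear limit `e^{ρ₀} = e^{ρ₁} = E_k = 2πi/(1 - e^c u_k)`, `ρ₁ = ρ₀ + 2πik`,
`u_k = e^{2πi(1-r₀)k}`, continued by the implicit function theorem
(`ZilberEacDiagonalCriticalExistence`); along the solutions `x₁ - x₀ → 2πik`, `x₀/m → 2πi`,
`y₂/m → e^c E_k u_k = Φ(u_k)`; the pairs `(2πik, Φ(u_k))` are Zariski-generic in `ℂ²`
(`ZilberEacDiagonalCriticalGeneric`, irrational rotation + a Möbius numerator), so THEOREM N₂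
(`ZilberEacDiagonalCriticalElimination`) gives density.

Corollaries: `polyFibredGraph_critical_const_member_dense` (all seven `ECCell 3 2` hypotheses, not
linearly split, `W ∩ Γ_exp ≠ ∅`, dense — every `c`), **`sqrtTwoOneConst_member_dense`**
(`{x₂ = √2x₀ + (1 - √2)x₁ + 1, yⱼ = xⱼ + y₂}`: `Re c ≠ 0`, outside the near-resonant regime), and a
second proof of the `c = 0` case (`ZilberEacNearResonantDensity.sqrtTwoOne_member_dense`).

HONEST FRAMING: explicit families inside an OPEN cell; non-constant fibres at critical size, the
super-critical sizes and O54 (b)'s `x₂ = -(x₀-x₁)² + x₀` stay open; `EC(3,2)` OPEN; NOT Schanuel's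
conjecture; EAC ⇏ SC.
-/

noncomputable section

open Complex MvPolynomial Filter Topology
open Literature.NumberTheory.Transcendental Literature.ModelTheory.Zilber
  Literature.ModelTheory.ExponentialFields

set_option linter.dupNamespace false

namespace Summit.Schanuel.Schanuel.Theorems

section CriticalConst

/-- **THEOREM (Zariski density at critical size, every hyperplane constant).**  For irrational `r₀`
and every `c ∈ ℂ` the exponential points of
`W_{r,c} = {x₂ = r₀x₀ + (1 - r₀)x₁ + c, y₀ = x₀ + y₂, y₁ = x₁ + y₂}` are Zariski dense.  See the module
docstring. (new) [cite: MantovaMasser2023, §1 p.5 (the open case dim π(V) = 2 in ℂ³×ℂˣ³)] -/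
theorem unprojectedDense_polyFibredGraph_critical_const (r₀ : ℝ) (hr : Irrational r₀) (c : ℂ) :
    UnprojectedDense (polyFibredGraph (hyperplanePoly ![r₀, 1 - r₀] c) (fun j => X j)
      (fun _ => (1 : Polynomial ℂ).toMvPolynomial 0)) := by
  classical
  have hr1 : Irrational (1 - r₀) := by simpa using hr.ratCast_sub 1
  have hπ := Real.pi_pos
  have h2πI : (2 * Real.pi * I : ℂ) ≠ 0 := Complex.two_pi_I_ne_zero
  -- the rotating numbers and the limit ratios
  set u : ℕ → ℂ := fun k => exp (2 * Real.pi * I * ((1 - r₀ : ℝ) : ℂ) * (k : ℂ)) with hu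
  set T : ℕ → ℂ := fun k =>
    2 * Real.pi * I * ((1 : ℤ) : ℂ) * (exp c * u k) / (1 - exp c * u k) with hT
  set PS : Set (ℂ × ℂ) := {vt | ∃ k : ℕ, exp c * u k ≠ 1 ∧
    vt = (2 * Real.pi * I * (k : ℂ), T k)} with hPS
  have hgen : ∀ Q : MvPolynomial (Fin 2) ℂ, Q ≠ 0 → ∃ vt ∈ PS, eval ![vt.1, vt.2] Q ≠ 0 := by
    intro Q hQ
    obtain ⟨k, hgood, hne⟩ := diagonalCritical_pairs_generic hr1 c (p := 1) one_ne_zero Q hQ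
    exact ⟨_, ⟨k, hgood, rfl⟩, hne⟩
  set r : Fin 2 → ℝ := ![r₀, 1 - r₀] with hrdef
  refine unprojectedDense_of_bddLinLin (isIrreducibleClosed_polyFibredGraph _ _ _)
    (by rw [zariskiDim_polyFibredGraph]) ![Sum.inl 0, Sum.inl 1, Sum.inr (Fin.last 2)]
    (Wst := 2 * Real.pi * I) h2πI hgen ?_
  rintro _ ⟨k, hgood, rfl⟩
  -- the base point of the label `k`
  have hden : (1 : ℂ) - exp c * u k ≠ 0 := by
    intro h; apply hgood; linear_combination -h
  set E : ℂ := 2 * Real.pi * I / (1 - exp c * u k) with hE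
  have hE0 : E ≠ 0 := div_ne_zero h2πI hden
  have hEeq : E * (1 - exp c * u k) = 2 * Real.pi * I := by
    rw [hE, div_mul_cancel₀ _ hden]
  set ρs : ℂ × ℂ := (log E, log E + 2 * Real.pi * I * (k : ℂ)) with hρs
  have heE : exp (log E) = E := Complex.exp_log hE0
  have hek : exp (2 * Real.pi * I * (k : ℂ)) = 1 := by
    have := Complex.exp_int_mul_two_pi_mul_I (k : ℤ)
    rw [← this]; congr 1; push_cast; ring
  have hG : exp (c + (r₀ : ℂ) * ρs.1 + ((1 - r₀ : ℝ) : ℂ) * ρs.2) = exp c * E * u k := by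
    simp only [hρs, hu]
    rw [show c + (r₀ : ℂ) * log E + ((1 - r₀ : ℝ) : ℂ) * (log E + 2 * Real.pi * I * (k : ℂ)) =
      c + log E + 2 * Real.pi * I * ((1 - r₀ : ℝ) : ℂ) * (k : ℂ) by push_cast; ring,
      Complex.exp_add, Complex.exp_add, heE]
  have h0 : exp ρs.1 = 2 * Real.pi * I * ((1 : ℤ) : ℂ) +
      exp (c + (r₀ : ℂ) * ρs.1 + ((1 - r₀ : ℝ) : ℂ) * ρs.2) := by
    rw [hG]
    simp only [hρs, heE]
    push_cast
    linear_combination hEeq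
  have h1 : exp ρs.2 = 2 * Real.pi * I * ((1 : ℤ) : ℂ) +
      exp (c + (r₀ : ℂ) * ρs.1 + ((1 - r₀ : ℝ) : ℂ) * ρs.2) := by
    rw [hG]
    simp only [hρs]
    rw [Complex.exp_add, heE, hek]
    push_cast
    linear_combination hEeq
  have hTk : T k = exp c * E * u k := by
    simp only [hT, hE]
    push_cast
    field_simp
  -- the solutions
  obtain ⟨x, ρ, hρ, hx0, hx1, hsol⟩ :=
    exists_solutions_diagonalCritical r₀ c (p := 1) one_ne_zero h0 h1
  set P : ℕ → Fin 3 ⊕ Fin 3 → ℂ := fun m =>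
    pgParam (hyperplanePoly r c) (fun j => X j) (fun _ => (1 : Polynomial ℂ).toMvPolynomial 0)
      (x m) (exp (∑ i, (r i : ℂ) * x m i + c)) with hP
  have hρ1 : Tendsto (fun m => (ρ m).1) atTop (𝓝 ρs.1) := (continuous_fst.tendsto _).comp hρ
  have hρ2 : Tendsto (fun m => (ρ m).2) atTop (𝓝 ρs.2) := (continuous_snd.tendsto _).comp hρ
  have hs0 : Tendsto (fun m : ℕ => (((1 / (m : ℝ) : ℝ)) : ℂ)) atTop (𝓝 0) := by
    have h := (continuous_ofReal.tendsto (0 : ℝ)).comp tendsto_one_div_atTop_nhds_zero_nat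
    rw [ofReal_zero] at h
    exact h
  have hl0 : Tendsto (fun m : ℕ => (((Real.log m / (m : ℝ) : ℝ)) : ℂ)) atTop (𝓝 0) := by
    have h := (continuous_ofReal.tendsto (0 : ℝ)).comp
      (tendsto_log_pow_div_natCast_comp (d := fun m => m) tendsto_id 1)
    rw [ofReal_zero] at h
    refine h.congr fun m => ?_
    simp only [Function.comp_apply, pow_one]
  refine ⟨P, fun m => (m : ℝ), ?_, tendsto_natCast_atTop_atTop, ?_, ?_, ?_⟩
  · -- membership, eventually
    filter_upwards [hsol] with m hm
    refine ⟨pgParam_mem _ _ _ _ _,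
      pgParam_hyperplane_mem_expGraph r c (fun j => X j) (fun _ => (1 : Polynomial ℂ)) fun j => ?_⟩
    rw [eval_X, Polynomial.eval_one, mul_one]
    exact hm j
  · -- `x₁ - x₀ → 2πik`
    have hlim : Tendsto (fun m => (ρ m).2 - (ρ m).1) atTop (𝓝 (ρs.2 - ρs.1)) := hρ2.sub hρ1
    have e : ρs.2 - ρs.1 = 2 * Real.pi * I * (k : ℂ) := by simp only [hρs]; ring
    rw [e] at hlim
    refine hlim.congr fun m => ?_
    have e0 : (Sum.inl 0 : Fin 3 ⊕ Fin 3) = Sum.inl (Fin.castSucc (0 : Fin 2)) := rfl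
    have e1 : (Sum.inl 1 : Fin 3 ⊕ Fin 3) = Sum.inl (Fin.castSucc (1 : Fin 2)) := rfl
    simp only [hP, Matrix.cons_val_one, Matrix.cons_val_zero, e0, e1, pgParam_inl_castSucc,
      hx0 m, hx1 m]
    ring
  · -- `x₀ / m → 2πi`
    have hlim : Tendsto (fun m : ℕ => 2 * Real.pi * I + (((Real.log m / (m : ℝ) : ℝ)) : ℂ) +
        (ρ m).1 * (((1 / (m : ℝ) : ℝ)) : ℂ)) atTop (𝓝 (2 * Real.pi * I + 0 + ρs.1 * 0)) :=
      (tendsto_const_nhds.add hl0).add (hρ1.mul hs0)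
    simp only [add_zero, mul_zero] at hlim
    refine hlim.congr' ?_
    filter_upwards [eventually_ge_atTop 1] with m hm
    have hmC : (m : ℂ) ≠ 0 := by exact_mod_cast (show m ≠ 0 by omega)
    have e0 : (Sum.inl 0 : Fin 3 ⊕ Fin 3) = Sum.inl (Fin.castSucc (0 : Fin 2)) := rfl
    simp only [hP, Matrix.cons_val_zero, e0, pgParam_inl_castSucc, hx0 m]
    push_cast
    field_simp
  · -- `y₂ / m → e^c E u_k = T k`
    have hlim : Tendsto (fun m => exp (c + (r₀ : ℂ) * (ρ m).1 + ((1 - r₀ : ℝ) : ℂ) * (ρ m).2)) atTop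
        (𝓝 (exp (c + (r₀ : ℂ) * ρs.1 + ((1 - r₀ : ℝ) : ℂ) * ρs.2))) :=
      (Complex.continuous_exp.tendsto _).comp
        ((tendsto_const_nhds.add (tendsto_const_nhds.mul hρ1)).add (tendsto_const_nhds.mul hρ2))
    rw [hG, ← hTk] at hlim
    refine hlim.congr' ?_
    filter_upwards [eventually_ge_atTop 1] with m hm
    have hmpos : (0 : ℝ) < (m : ℝ) := by exact_mod_cast hm
    have hmC : (m : ℂ) ≠ 0 := by exact_mod_cast (show m ≠ 0 by omega)
    have hexpL : exp ((Real.log m : ℝ) : ℂ) = (m : ℂ) := by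
      rw [← Complex.ofReal_exp, Real.exp_log hmpos]
      push_cast
      rfl
    have hexpP : exp (2 * Real.pi * I * ((1 : ℤ) : ℂ) * (m : ℂ)) = 1 := by
      have := Complex.exp_int_mul_two_pi_mul_I (m : ℤ)
      rw [← this]; congr 1; push_cast; ring
    have hsum : (∑ i, (r i : ℂ) * x m i) + c = 2 * Real.pi * I * ((1 : ℤ) : ℂ) * (m : ℂ) +
        ((Real.log m : ℝ) : ℂ) + (c + (r₀ : ℂ) * (ρ m).1 + ((1 - r₀ : ℝ) : ℂ) * (ρ m).2) := by
      rw [Fin.sum_univ_two]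
      simp only [hrdef, Matrix.cons_val_zero, Matrix.cons_val_one, hx0 m, hx1 m]
      push_cast
      ring
    simp only [hP, Matrix.cons_val_two, Matrix.tail_cons, Matrix.head_cons, pgParam_inr,
      pMulParam_last]
    rw [hsum, Complex.exp_add (2 * Real.pi * I * ((1 : ℤ) : ℂ) * (m : ℂ) + ((Real.log m : ℝ) : ℂ)),
      Complex.exp_add (2 * Real.pi * I * ((1 : ℤ) : ℂ) * (m : ℂ)), hexpP, one_mul, hexpL]
    push_cast
    field_simp

/-- **Certified members of the open cell at critical size, every constant, dense.**  For irrational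
`r₀` and every `c`: all seven hypotheses of `ECCell 3 2` for `W_{r,c}`, not linearly split,
`W_{r,c} ∩ Γ_exp ≠ ∅`, `I(W_{r,c} ∩ Γ_exp) = I(W_{r,c})`. (new)
[cite: MantovaMasser2023, §1 p.5 (the open case dim π(V) = 2 in ℂ³×ℂˣ³)] -/
theorem polyFibredGraph_critical_const_member_dense (r₀ : ℝ) (hr : Irrational r₀) (c : ℂ) :
    (IsIrreducibleClosed ℂ (polyFibredGraph (hyperplanePoly ![r₀, 1 - r₀] c) (fun j => X j)
        (fun _ => (1 : Polynomial ℂ).toMvPolynomial 0)) ∧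
      (polyFibredGraph (hyperplanePoly ![r₀, 1 - r₀] c) (fun j => X j)
          (fun _ => (1 : Polynomial ℂ).toMvPolynomial 0) ∩ torusLocus ℂ 3).Nonempty ∧
      IsRotund ℂ 3 (polyFibredGraph (hyperplanePoly ![r₀, 1 - r₀] c) (fun j => X j)
          (fun _ => (1 : Polynomial ℂ).toMvPolynomial 0) ∩ torusLocus ℂ 3) ∧
      IsAddFree ℂ 3 (polyFibredGraph (hyperplanePoly ![r₀, 1 - r₀] c) (fun j => X j)
          (fun _ => (1 : Polynomial ℂ).toMvPolynomial 0) ∩ torusLocus ℂ 3) ∧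
      IsMulFree ℂ 3 (polyFibredGraph (hyperplanePoly ![r₀, 1 - r₀] c) (fun j => X j)
          (fun _ => (1 : Polynomial ℂ).toMvPolynomial 0) ∩ torusLocus ℂ 3) ∧
      zariskiDim ℂ (polyFibredGraph (hyperplanePoly ![r₀, 1 - r₀] c) (fun j => X j)
          (fun _ => (1 : Polynomial ℂ).toMvPolynomial 0)) = (3 : ℕ) ∧
      addProjDim ℂ 3 (polyFibredGraph (hyperplanePoly ![r₀, 1 - r₀] c) (fun j => X j)
          (fun _ => (1 : Polynomial ℂ).toMvPolynomial 0)) = (2 : ℕ)) ∧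
    ¬ IsLinearSplit ℂ 3 (polyFibredGraph (hyperplanePoly ![r₀, 1 - r₀] c) (fun j => X j)
        (fun _ => (1 : Polynomial ℂ).toMvPolynomial 0)) ∧
    (polyFibredGraph (hyperplanePoly ![r₀, 1 - r₀] c) (fun j => X j)
        (fun _ => (1 : Polynomial ℂ).toMvPolynomial 0) ∩ expGraph ℂ 3).Nonempty ∧
    UnprojectedDense (polyFibredGraph (hyperplanePoly ![r₀, 1 - r₀] c) (fun j => X j)
        (fun _ => (1 : Polynomial ℂ).toMvPolynomial 0)) := by
  have hA : Function.Injective (aeval (fun j : Fin 2 => (X j : MvPolynomial (Fin 2) ℂ)) :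
      MvPolynomial (Fin 2) ℂ →ₐ[ℂ] MvPolynomial (Fin 2) ℂ) := by
    rw [aeval_X_left]; exact fun _ _ h => h
  have hirr : ∃ i : Fin 2, Irrational ((![r₀, 1 - r₀] : Fin 2 → ℝ) i) := ⟨0, by simpa using hr⟩
  have hcell := ecCell_hypotheses_polyFibredGraph_hyperplane ![r₀, 1 - r₀] c (fun j => X j)
    (fun _ => (1 : Polynomial ℂ).toMvPolynomial 0) hA hirr
  have hdense := unprojectedDense_polyFibredGraph_critical_const r₀ hr c
  refine ⟨hcell, not_isLinearSplit_polyFibredGraph _ (fun j => X j) _ (by norm_num) hA, ?_,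
    hdense⟩
  obtain ⟨w, hw, -⟩ := hcell.2.1
  exact inter_expGraph_nonempty_of_vanishingIdeal_eq ⟨w, hw⟩ hdense

/-- **A critical example outside the near-resonant regime is dense.**
`W = {x₂ = √2 x₀ + (1 - √2) x₁ + 1, y₀ = x₀ + y₂, y₁ = x₁ + y₂} ⊆ ℂ³ × ℂ³`
(`e^z = z + e·e^{√2 z + (1-√2) w}`, `e^w = w + e·e^{√2 z + (1-√2) w}`; critical size, `Re c = 1 ≠ 0`):
all seven hypotheses of `ECCell 3 2`, not linearly split, `W ∩ Γ_exp ≠ ∅` AND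
`I(W ∩ Γ_exp) = I(W)`. (new) [cite: MantovaMasser2023, §1 p.5 (the open case dim π(V) = 2 in ℂ³×ℂˣ³)] -/
theorem sqrtTwoOneConst_member_dense :
    (IsIrreducibleClosed ℂ (polyFibredGraph (hyperplanePoly ![Real.sqrt 2, 1 - Real.sqrt 2] 1)
        (fun j => X j) (fun _ => (1 : Polynomial ℂ).toMvPolynomial 0)) ∧
      (polyFibredGraph (hyperplanePoly ![Real.sqrt 2, 1 - Real.sqrt 2] 1) (fun j => X j)
          (fun _ => (1 : Polynomial ℂ).toMvPolynomial 0) ∩ torusLocus ℂ 3).Nonempty ∧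
      IsRotund ℂ 3 (polyFibredGraph (hyperplanePoly ![Real.sqrt 2, 1 - Real.sqrt 2] 1)
          (fun j => X j) (fun _ => (1 : Polynomial ℂ).toMvPolynomial 0) ∩ torusLocus ℂ 3) ∧
      IsAddFree ℂ 3 (polyFibredGraph (hyperplanePoly ![Real.sqrt 2, 1 - Real.sqrt 2] 1)
          (fun j => X j) (fun _ => (1 : Polynomial ℂ).toMvPolynomial 0) ∩ torusLocus ℂ 3) ∧
      IsMulFree ℂ 3 (polyFibredGraph (hyperplanePoly ![Real.sqrt 2, 1 - Real.sqrt 2] 1)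
          (fun j => X j) (fun _ => (1 : Polynomial ℂ).toMvPolynomial 0) ∩ torusLocus ℂ 3) ∧
      zariskiDim ℂ (polyFibredGraph (hyperplanePoly ![Real.sqrt 2, 1 - Real.sqrt 2] 1)
          (fun j => X j) (fun _ => (1 : Polynomial ℂ).toMvPolynomial 0)) = (3 : ℕ) ∧
      addProjDim ℂ 3 (polyFibredGraph (hyperplanePoly ![Real.sqrt 2, 1 - Real.sqrt 2] 1)
          (fun j => X j) (fun _ => (1 : Polynomial ℂ).toMvPolynomial 0)) = (2 : ℕ)) ∧
    ¬ IsLinearSplit ℂ 3 (polyFibredGraph (hyperplanePoly ![Real.sqrt 2, 1 - Real.sqrt 2] 1)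
        (fun j => X j) (fun _ => (1 : Polynomial ℂ).toMvPolynomial 0)) ∧
    (polyFibredGraph (hyperplanePoly ![Real.sqrt 2, 1 - Real.sqrt 2] 1) (fun j => X j)
        (fun _ => (1 : Polynomial ℂ).toMvPolynomial 0) ∩ expGraph ℂ 3).Nonempty ∧
    UnprojectedDense (polyFibredGraph (hyperplanePoly ![Real.sqrt 2, 1 - Real.sqrt 2] 1)
        (fun j => X j) (fun _ => (1 : Polynomial ℂ).toMvPolynomial 0)) :=
  polyFibredGraph_critical_const_member_dense (Real.sqrt 2) irrational_sqrt_two 1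

end CriticalConst

end Summit.Schanuel.Schanuel.Theorems

end
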